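import Literature.NumberTheory.LFunctions.ExplicitExceptionalZeroBoundsRealCharacters
import Literature.NumberTheory.LFunctions.NoRealZeroTruncationLadder10000
import Literature.NumberTheory.LFunctions.DirichletExplicitRegionTheoremOne
import Literature.NumberTheory.LFunctions.Zhang2022.DHChainInputs
import HarnessLib

/-!
# The lower half of Benli–Goel–Twiss–Zaman's Lemma 2.9 for EVERY real non-principal character,
# unconditionally (`0.72 (1 − β₁) ≤ L(1,χ₁)`, `q ≥ 10⁴`; Platt's table replaced by the kernel floor
# `NoRealZeroUpTo 10000`), and the B-dh row dhE-12 `exceptionalZero_of_assumptionA` with NO named fact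

Topic `Literature/NumberTheory/LFunctions` (namespace `Literature.NumberTheory.LFunctions`; cell
`parity-realchar`, D-0088 (4) literature-typing row (7) «conditionals column + instrument provenance»,
seat `littype-FP2-1`). Everything is PROVED (standard axioms); no definition, no named fact.

K. Benli, S. Goel, H. Twiss, A. Zaman, Proc. Amer. Math. Soc. 154 (2026) 509–525, **Lemma 2.9** (named fact
`BGTZ2025.lemma29`): «Let `q > 400 000` … If `1 − 1/(10 log q) < β₁ < 1` is a real zero of `L(s, χ₁)` where
`χ₁ (mod q)` is a real quadratic character, then `0.72 ≤ L(1,χ₁)/(1 − β₁) ≤ 0.18 (log q)²`.» The tree proved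
the LOWER inequality for every quadratic `χ₁ ≠ χ₀` (primitive or not) with the kernel constant `0.81`
MODULO Platt's certified table (`BGTZ2025.lOne_ge_of_realZero_tenth_of_platt`, `BGTZ2025.lemma29_lower_of_platt`,
`ExplicitExceptionalZeroBoundsRealCharacters.lean`): Platt 2016 Thm 7.1 (`platt2016_theorem71`) was used only
to exclude a real zero of the inducing primitive character `χ⋆` when its conductor is `≤ 4·10⁵`, the
a-priori repulsion `1 − β ≥ 1000/q′²` (`RealZeroRepulsion.thousand_div_sq_le_one_sub_realZero`) needing
`q′ ≥ 10⁴`. **Here that exclusion is supplied by the tree's KERNEL floor `noRealZeroUpTo_10000 :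
NoRealZeroUpTo 10000`** (`NoRealZeroTruncationLadder10000.lean`, hypothesis-free: no primitive quadratic
`L(s,χ)` of conductor `3 ≤ q′ ≤ 10 000` vanishes on `(0,1)`), so the lower half holds with NO named fact, and
already from `q ≥ 10⁴`:

* `BGTZ2025.lOne_ge_of_realZero_tenth_all` — `q ≥ 10⁴`, `χ` mod `q` quadratic, `χ ≠ χ₀`, real zero
  `β ∈ (1 − 1/(10 log q), 1)` ⇒ `0.81 (1 − β) ≤ Re L(1,χ)`;
* `BGTZ2025.lemma29_lower` — the first conjunct of the named fact `BGTZ2025.lemma29` in its own binder shape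
  (`q > 4·10⁵`, `0.72`), unconditionally (supersedes `BGTZ2025.lemma29_lower_of_platt`).

(The UPPER inequality is supported in print for primitive `χ₁` only — cell ruling E-lemma29-upper — and is
kernel for primitive `χ₁` with the printed `0.18` in `LandauSiegelZeroLOneTwoSidedPrimitive.lean`; for
imprimitive `χ₁` the Euler factor `∏_{p ∣ q, p ∤ q′}(1 − χ⋆(p)/p)` of `L(1,χ₁)` is uncontrolled.)

Consequence for the B-dh chain inputs (`Zhang2022/DHChainInputs.lean`, row dhE-12): its theorem
`DH.exceptionalZero_of_assumptionA` carried the two print facts `(h29 : BGTZ2025.lemma29)`,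
`(hM : McCurley1984_theorem1)` as hypotheses, using `h29` only through the lower half
(`DH.exceptionalZero_of_assumptionA_of_lower`); McCurley's Theorem 1 is a kernel theorem since
`McCurley1984_theorem1_holds` (`DirichletExplicitRegionTheoremOne.lean`). Hence
`DH.exceptionalZero_of_assumptionA'` below — **the same statement with NO hypothesis** (the companions
`quasiRH_of_assumptionA` / `familyZeroDensity_of_assumptionA` keep their genuine print inputs
`BGTZ2025.corollary11` / `thornerZaman2024_theorem12` ONLY: `quasiRH_of_assumptionA'`,
`familyZeroDensity_of_assumptionA'` below, proofs verbatim with the two binders discharged).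

## References

* [BenliGoelTwissZaman2025] Lemma 2.9 (arXiv:2410.06082 = Proc. AMS 154 (2026) 509–525).
* [MontgomeryVaughan2007] §11.2 (11.10) (the kernel master inequality, `RealZeroLOneLowerBoundExplicit.lean`).
* [Chua2005RealZeros] Theorem 1.1, [Watkins2004RealZeros] (print comparators of the kernel floor `10 000`).
* [Zhang2022LandauSiegel] §2 Assumption (A), §5 Lemma 5.5; [McCurley1984ZFR] Theorem 1.
-/

noncomputable section

open Complex Real

namespace Literature.NumberTheory.LFunctions

/-- `e^{3/5} < 1.823`. [folklore] -/
private theorem exp_three_fifths_lt_aux : Real.exp (3 / 5) < 1.823 := by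
  have h := Real.exp_one_lt_d9
  have h0 : 0 < Real.exp 1 := Real.exp_pos 1
  have e5 : Real.exp (3 / 5) ^ 5 = Real.exp 1 ^ 3 := by
    rw [← Real.exp_nat_mul, ← Real.exp_nat_mul]; norm_num
  have h3 : Real.exp 1 ^ 3 < 2.7182818286 ^ 3 := pow_lt_pow_left₀ h h0.le (by norm_num)
  by_contra hge
  rw [not_lt] at hge
  have h5 : (1.823 : ℝ) ^ 5 ≤ Real.exp (3 / 5) ^ 5 := pow_le_pow_left₀ (by norm_num) hge 5
  have : (2.7182818286 : ℝ) ^ 3 < 1.823 ^ 5 := by norm_num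
  linarith

/-- The primitive character inducing a quadratic character is quadratic. [folklore] -/
private theorem primitiveCharacter_isQuadratic_aux {q : ℕ} [NeZero q] {χ : DirichletCharacter ℂ q}
    (hquad : χ.IsQuadratic) : χ.primitiveCharacter.IsQuadratic := by
  have hχψ : DirichletCharacter.changeLevel χ.conductor_dvd_level χ.primitiveCharacter = χ :=
    DirichletCharacter.changeLevel_primitiveCharacter χ
  have hsq : χ ^ 2 = 1 := MulChar.isQuadratic_iff_sq_eq_one.mp hquad
  exact MulChar.isQuadratic_iff_sq_eq_one.mpr
    (DirichletCharacter.changeLevel_injective χ.conductor_dvd_level (by rw [map_pow, hχψ, hsq, map_one]))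

/-- `9 ≤ log q` for `q ≥ 10⁴`. [folklore] -/
private theorem nine_le_log_aux {q : ℕ} (hq : 10 ^ 4 ≤ q) : (9 : ℝ) ≤ Real.log q := by
  have hq' : (10 ^ 4 : ℝ) ≤ q := by exact_mod_cast hq
  rw [Real.le_log_iff_exp_le (by linarith)]
  have h3 : Real.exp 9 = Real.exp 1 ^ 9 := by rw [← Real.exp_nat_mul]; norm_num
  have he : Real.exp 1 < 2.7182818286 := Real.exp_one_lt_d9
  have h9 : Real.exp 1 ^ 9 < (2.7182818286 : ℝ) ^ 9 :=
    pow_lt_pow_left₀ he (Real.exp_pos 1).le (by norm_num)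
  rw [h3]; nlinarith

/-- **The lower half of BGTZ 2025 Lemma 2.9 with the kernel constant, for EVERY real non-principal
character, UNCONDITIONALLY, from `q ≥ 10⁴`:** for `χ` mod `q ≥ 10⁴` quadratic, `χ ≠ χ₀` (primitive or not),
and a real zero `β` of `L(s,χ)` with `1 − 1/(10 log q) < β < 1`: **`0.81 (1 − β) ≤ Re L(1,χ)`**. Route (as
in `BGTZ2025.lOne_ge_of_realZero_tenth_of_platt`, Platt's table replaced): `χ⋆` mod `q′ ∣ q` primitive
quadratic with `L(β,χ⋆) = 0`; `q′ ≤ 10 000` is impossible by the KERNEL floor `noRealZeroUpTo_10000`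
(`q′ ≥ 3`: `q′ = 1` would make `χ` principal, `q′ = 2` carries no primitive character); for `q′ > 10⁴` the
kernel repulsion at level `q′` gives `1 − β ≥ 1000/q′² ≥ 1000/q²`, and the kernel master inequality at
level `q` (window `1/(10 log q)`, `e^{6(1−β) log q} ≤ e^{3/5} < 1.823`, `1.4913/1.823 − 0.0041 > 0.81`)
concludes. [cite: BenliGoelTwissZaman2025, Lemma 2.9] [cite: MontgomeryVaughan2007, §11.2 (11.10)] -/
theorem BGTZ2025.lOne_ge_of_realZero_tenth_all {q : ℕ} [NeZero q] (hq : 10 ^ 4 ≤ q)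
    {χ : DirichletCharacter ℂ q} (hquad : χ.IsQuadratic) (hχ : χ ≠ 1) {β : ℝ}
    (hlo : 1 - 1 / (10 * Real.log q) < β) (hβ1 : β < 1) (hz : χ.LFunction β = 0) :
    0.81 * (1 - β) ≤ (χ.LFunction 1).re := by
  have hlog := nine_le_log_aux hq
  have hL0 : 0 < Real.log q := by linarith
  have hβ0 : 0 < β := by
    have : 1 / (10 * Real.log q) ≤ 1 / 90 := by
      apply one_div_le_one_div_of_le (by norm_num); linarith
    linarith
  -- the inducing primitive character
  haveI : NeZero χ.conductor := ⟨χ.conductor_ne_zero⟩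
  set ψ := χ.primitiveCharacter with hψdef
  have hχψ : DirichletCharacter.changeLevel χ.conductor_dvd_level ψ = χ :=
    DirichletCharacter.changeLevel_primitiveCharacter χ
  have hψ1 : ψ ≠ 1 := fun h' => hχ (by rw [← hχψ, h', map_one])
  have hψquad : ψ.IsQuadratic := primitiveCharacter_isQuadratic_aux hquad
  have hψprim : ψ.IsPrimitive := DirichletCharacter.primitiveCharacter_isPrimitive χ
  have hdq : χ.conductor ≤ q := Nat.le_of_dvd (Nat.pos_of_ne_zero (NeZero.ne q)) χ.conductor_dvd_level
  have hzψ : ψ.LFunction β = 0 :=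
    (DirichletCharacter.LFunction_eq_zero_iff_primitiveCharacter χ (s := (β : ℂ))
      (by simpa using hβ0) (by
        intro h1
        have := congrArg Complex.re h1
        simp at this
        linarith)).mp hz
  -- the conductor is at least `3`
  have hc1 : χ.conductor ≠ 1 := fun h => hχ (DirichletCharacter.eq_one_iff_conductor_eq_one.mpr h)
  have hc2 : χ.conductor ≠ 2 := by
    intro h2
    have hsub : Subsingleton (ZMod χ.conductor)ˣ := by
      refine Fintype.card_le_one_iff_subsingleton.mp ?_
      rw [ZMod.card_units_eq_totient, h2, Nat.totient_two]
    exact hψ1 (MulChar.ext fun a => by rw [Subsingleton.elim a 1, Units.val_one, map_one, map_one])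
  have hc3 : 3 ≤ χ.conductor := by
    have := χ.conductor_ne_zero
    omega
  -- a-priori bound `1000/q² ≤ 1 − β`
  have hrep : 1000 / (q : ℝ) ^ 2 ≤ 1 - β := by
    rcases le_or_gt χ.conductor 10000 with hd | hd
    · -- kernel floor: `L(s, χ⋆)` has no real zero in `(0,1)` for conductor `≤ 10 000`
      exact absurd hzψ (noRealZeroUpTo_10000 χ.conductor hc3 hd ψ hψquad hψprim β hβ0 hβ1)
    · have hd4 : 10 ^ 4 ≤ χ.conductor := by omega
      have h := RealZeroRepulsion.thousand_div_sq_le_one_sub_realZero ψ hd4 hψprim hψquad hzψ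
      have hd0 : (0 : ℝ) < χ.conductor := by exact_mod_cast (show 0 < χ.conductor by omega)
      have hdqR : (χ.conductor : ℝ) ≤ q := by exact_mod_cast hdq
      have : 1000 / (q : ℝ) ^ 2 ≤ 1000 / (χ.conductor : ℝ) ^ 2 :=
        div_le_div_of_nonneg_left (by norm_num) (by positivity) (pow_le_pow_left₀ hd0.le hdqR 2)
      linarith
  -- the kernel master inequality at level `q` (no primitivity needed), window `1/(10 log q)`
  have hβ4 : 1 - 1 / (4 * Real.log q) ≤ β := by
    have : 1 / (10 * Real.log q) ≤ 1 / (4 * Real.log q) :=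
      one_div_le_one_div_of_le (by positivity) (by linarith)
    linarith
  have hm := RealZeroRepulsion.lOne_ge_of_realZero_master χ hq hχ hquad.sq_eq_one hz hβ4 hrep
  have hκ0 : 0 < 1 - β := by linarith
  have h6 : 6 * (1 - β) * Real.log q ≤ 3 / 5 := by
    have h1 : 1 - β ≤ 1 / (10 * Real.log q) := by linarith
    have h2 : (1 - β) * Real.log q ≤ 1 / (10 * Real.log q) * Real.log q :=
      mul_le_mul_of_nonneg_right h1 hL0.le
    have h3 : 1 / (10 * Real.log q) * Real.log q = 1 / 10 := by field_simp
    linarith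
  have hW : Real.exp (6 * (1 - β) * Real.log q) ≤ 1.823 :=
    le_trans (Real.exp_le_exp.mpr h6) exp_three_fifths_lt_aux.le
  have hdiv : 1.4913 / 1.823 ≤ 1.4913 / Real.exp (6 * (1 - β) * Real.log q) :=
    div_le_div_of_nonneg_left (by norm_num) (Real.exp_pos _) hW
  have hc : (0.81 : ℝ) ≤ 1.4913 / Real.exp (6 * (1 - β) * Real.log q) - 0.0041 := by
    have : (0.81 : ℝ) + 0.0041 ≤ 1.4913 / 1.823 := by norm_num
    linarith
  calc 0.81 * (1 - β) = (1 - β) * 0.81 := by ring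
    _ ≤ (1 - β) * (1.4913 / Real.exp (6 * (1 - β) * Real.log q) - 0.0041) :=
        mul_le_mul_of_nonneg_left hc hκ0.le
    _ ≤ (χ.LFunction 1).re := hm

/-- **BGTZ 2025 Lemma 2.9, LOWER inequality, in the named fact's own binder shape — unconditionally:**
`0.72 (1 − β₁) ≤ Re L(1,χ₁)` for every quadratic `χ₁ ≠ χ₀` mod `q > 4·10⁵` and every real zero
`β₁ ∈ (1 − 1/(10 log q), 1)` (the first conjunct of `BGTZ2025.lemma29`; `0.72 ≤ 0.81`). Supersedes
`BGTZ2025.lemma29_lower_of_platt`. [cite: BenliGoelTwissZaman2025, Lemma 2.9] -/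
theorem BGTZ2025.lemma29_lower :
    ∀ (q : ℕ) [NeZero q], 400000 < q → ∀ χ₁ : DirichletCharacter ℂ q, χ₁.IsQuadratic → χ₁ ≠ 1 →
      ∀ β₁ : ℝ, 1 - 1 / (10 * Real.log q) < β₁ → β₁ < 1 → χ₁.LFunction β₁ = 0 →
        0.72 * (1 - β₁) ≤ (χ₁.LFunction 1).re := by
  intro q _ hq χ₁ hquad hχ β₁ hlo hβ1 hz
  have h := BGTZ2025.lOne_ge_of_realZero_tenth_all (by omega) hquad hχ hlo hβ1 hz
  have : 0 ≤ 1 - β₁ := by linarith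
  nlinarith

/-- The lower inequality from `q ≥ 10⁴` in the same binder shape (`0.72`; the print's threshold is
`4·10⁵`). [cite: BenliGoelTwissZaman2025, Lemma 2.9] -/
theorem BGTZ2025.lemma29_lower_of_ge {q : ℕ} [NeZero q] (hq : 10 ^ 4 ≤ q)
    {χ₁ : DirichletCharacter ℂ q} (hquad : χ₁.IsQuadratic) (hχ : χ₁ ≠ 1) {β₁ : ℝ}
    (hlo : 1 - 1 / (10 * Real.log q) < β₁) (hβ1 : β₁ < 1) (hz : χ₁.LFunction β₁ = 0) :
    0.72 * (1 - β₁) ≤ (χ₁.LFunction 1).re := by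
  have h := BGTZ2025.lOne_ge_of_realZero_tenth_all hq hquad hχ hlo hβ1 hz
  have : 0 ≤ 1 - β₁ := by linarith
  nlinarith

namespace Zhang2022.DH

/-- **Row dhE-12 with NO hypothesis.** The statement of `DH.exceptionalZero_of_assumptionA` — under
Zhang's Assumption (A) and for all large `D`: the exceptional zero `β₁ ∈ (1 − 1/(10 log D), 1)` of
`L(s,χ)`, simple, `χ² = χ₀`, unique among all `L(s,ψ)` mod `D` in the window, with
`0.72 (1 − β₁) ≤ ‖L(1,χ)‖` and `1 − β₁ < (25/18)(log D)⁻²⁰²²` — with its two print-fact binders discharged: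
`(h29 : BGTZ2025.lemma29)` by the kernel lower half `BGTZ2025.lemma29_lower` (this file) and
`(hM : McCurley1984_theorem1)` by `McCurley1984_theorem1_holds`.
[cite: Zhang2022LandauSiegel, §2 Assumption (A) and §5 Lemma 5.5]
[cite: BenliGoelTwissZaman2025, Lemma 2.9 and Corollary 1.1] [cite: McCurley1984ZFR, Theorem 1] -/
theorem exceptionalZero_of_assumptionA' :
    ∃ D₀ : ℕ, ∀ (D : ℕ) [NeZero D], D₀ ≤ D → ∀ χ : DirichletCharacter ℂ D, χ ≠ 1 →
      Skeleton.AssumptionA D χ →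
      ∃ β₁ : ℝ, 1 - 1 / (10 * Real.log D) < β₁ ∧ β₁ < 1 ∧ χ.LFunction β₁ = 0 ∧
        deriv χ.LFunction β₁ ≠ 0 ∧ χ ^ 2 = 1 ∧
        (∀ (ψ : DirichletCharacter ℂ D) (β : ℝ), 1 - 1 / (10 * Real.log D) < β → β < 1 →
            ψ.LFunction β = 0 → ψ = χ ∧ β = β₁) ∧
        0.72 * (1 - β₁) ≤ ‖χ.LFunction 1‖ ∧
        1 - β₁ < 25 / 18 / Real.log D ^ 2022 :=
  exceptionalZero_of_assumptionA_of_lower BGTZ2025.lemma29_lower McCurley1984_theorem1_holds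

/-- **The (A)-world explicit quasi-Riemann hypothesis, modulo `BGTZ2025.corollary11` ONLY** — the statement
of `quasiRH_of_assumptionA` with `(h29 : BGTZ2025.lemma29)` and `(hM : McCurley1984_theorem1)` discharged
(kernel lower half `BGTZ2025.lemma29_lower`, `McCurley1984_theorem1_holds`); proof verbatim from
`exceptionalZero_of_assumptionA'`. [cite: BenliGoelTwissZaman2025, Corollary 1.1 and Lemma 2.9]
[cite: Zhang2022LandauSiegel, §2 Assumption (A)] [cite: McCurley1984ZFR, Theorem 1] -/
theorem quasiRH_of_assumptionA' (h11 : BGTZ2025.corollary11) :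
    ∃ D₀ : ℕ, ∀ (D : ℕ) [NeZero D], D₀ ≤ D → ∀ χ : DirichletCharacter ℂ D, χ ≠ 1 →
      Skeleton.AssumptionA D χ →
      ∃ β₁ : ℝ, 1 - 1 / (10 * Real.log D) < β₁ ∧ β₁ < 1 ∧ χ.LFunction β₁ = 0 ∧
        1 - β₁ < 25 / 18 / Real.log D ^ 2022 ∧
        ∀ (q : ℕ) [NeZero q], D ∣ q → Real.log q ≤ 9 / 125 * Real.log D ^ 2022 →
          ∀ T : ℝ, 4 ≤ T → ∀ (ψ : DirichletCharacter ℂ q) (ρ : ℂ), ρ ≠ 1 → ρ ≠ ((β₁ : ℝ) : ℂ) →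
            ψ.LFunction ρ = 0 → 1 / 2 < ρ.re → |ρ.im| ≤ T →
              ρ.re < BGTZ2025.repulsionBound 10 1 107 (1 / 16) q T β₁ ∧
              ρ.re < 1 - (2022 * Real.log (Real.log D) + Real.log (9 / 200) -
                  Real.log (10 * Real.log q + Real.log T + 107)) /
                (10 * Real.log q + Real.log T + 107) := by
  obtain ⟨D₀, H⟩ := exceptionalZero_of_assumptionA'
  refine ⟨max D₀ 400001, fun D _ hD χ hχ hA => ?_⟩
  have hD₀ : D₀ ≤ D := le_trans (le_max_left _ _) hD
  have hD4 : 400001 ≤ D := le_trans (le_max_right _ _) hD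
  obtain ⟨β₁, hlo, hhi, hz, -, -, -, h72, hgap⟩ := H D hD₀ χ hχ hA
  have hD4r : (400001 : ℝ) ≤ D := by exact_mod_cast hD4
  have hlogD : 1 < Real.log D := by
    rw [Real.lt_log_iff_exp_lt (by linarith)]
    linarith [Real.exp_one_lt_d9]
  have hLpos : 0 < Real.log D ^ 2022 := by positivity
  have h1β : 0 < 1 - β₁ := by linarith
  refine ⟨β₁, hlo, hhi, hz, hgap, fun q _ hdvd hlogq T hT ψ ρ hρ1 hρβ hρ0 hre him => ?_⟩
  -- sizes at level `q`
  have hqD : D ≤ q := Nat.le_of_dvd (Nat.pos_of_ne_zero (NeZero.ne q)) hdvd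
  have hq4 : 400000 < q := lt_of_lt_of_le (by norm_num) (le_trans hD4 hqD)
  have hqr : (400001 : ℝ) ≤ q := by exact_mod_cast le_trans hD4 hqD
  have hlogq1 : 1 < Real.log q := by
    rw [Real.lt_log_iff_exp_lt (by linarith)]
    linarith [Real.exp_one_lt_d9]
  have hlogT : 0 < Real.log T := Real.log_pos (by linarith)
  set K : ℝ := 10 * Real.log q + Real.log T + 107 with hKdef
  have hK : 0 < K := by rw [hKdef]; positivity
  -- the window at level `q`: `1 − 1/(10 log q) < β₁`
  have hwin : 1 - 1 / (10 * Real.log q) < β₁ := by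
    have h1 : 25 / 18 / Real.log D ^ 2022 ≤ 1 / (10 * Real.log q) := by
      rw [div_le_div_iff₀ hLpos (by positivity)]
      nlinarith
    linarith
  -- `β₁` is a zero of `L(s, χ lifted to level q)`
  have hzq : (DirichletCharacter.changeLevel hdvd χ).LFunction β₁ = 0 := by
    rw [DirichletCharacter.LFunction_changeLevel hdvd χ (Or.inl hχ), hz, zero_mul]
  -- Corollary 1.1 at level `q`
  have hrep := h11 q hq4 T hT (DirichletCharacter.changeLevel hdvd χ) β₁ hwin hhi hzq ψ ρ hρ1 hρβ
    hρ0 hre him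
  refine ⟨hrep, lt_trans hrep ?_⟩
  -- explicit form: `repulsionBound < 1 − (log((9/200) (log D)^2022 / K))/K`
  have hX : 9 / 200 * Real.log D ^ 2022 / K < 1 / 16 / ((1 - β₁) * K) := by
    rw [div_lt_div_iff₀ hK (by positivity)]
    -- `(9/200) L^2022 ((1-β₁) K) < (1/16) K` since `(1-β₁) L^2022 < 25/18`
    have h2 : (1 - β₁) * Real.log D ^ 2022 < 25 / 18 := by
      rwa [lt_div_iff₀ hLpos] at hgap
    nlinarith
  have hYpos : 0 < 9 / 200 * Real.log D ^ 2022 / K := by positivity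
  have hlog : Real.log (9 / 200 * Real.log D ^ 2022 / K) <
      Real.log (1 / 16 / ((1 - β₁) * K)) := Real.log_lt_log hYpos hX
  have hexp : Real.log (9 / 200 * Real.log D ^ 2022 / K) =
      2022 * Real.log (Real.log D) + Real.log (9 / 200) - Real.log K := by
    rw [Real.log_div (by positivity) hK.ne', Real.log_mul (by norm_num) (by positivity),
      Real.log_pow]
    push_cast
    ring
  unfold BGTZ2025.repulsionBound
  rw [← hexp]
  have hKq : (10 : ℝ) * Real.log q + 1 * Real.log T + 107 = K := by rw [hKdef]; ring
  rw [hKq]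
  have := div_lt_div_of_pos_right hlog hK
  linarith

/-- **The (A)-world zero-density saving (row dhE-04 under (A)), modulo `thornerZaman2024_theorem12` ONLY** —
the statement of `familyZeroDensity_of_assumptionA` with `(h29 : BGTZ2025.lemma29)` and
`(hM : McCurley1984_theorem1)` discharged; proof verbatim from `exceptionalZero_of_assumptionA'`.
[cite: ThornerZaman2024LogFree, Theorem 1.2] [cite: Zhang2022LandauSiegel, §2 Assumption (A)]
[cite: BenliGoelTwissZaman2025, Lemma 2.9] -/
theorem familyZeroDensity_of_assumptionA' (h12 : thornerZaman2024_theorem12) :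
    ∃ D₀ : ℕ, ∀ (D : ℕ) [NeZero D], D₀ ≤ D → ∀ χ : DirichletCharacter ℂ D, χ ≠ 1 → χ.IsPrimitive →
      Skeleton.AssumptionA D χ →
      ∀ Q : ℝ, (D : ℝ) ≤ Q → ∀ σ : ℝ, 39 / 40 ≤ σ →
        (ThornerZaman2024.zeroCountExcl σ Q : ℝ) ≤
          10 ^ 93 * (25 / 18 / Real.log D ^ 2022 * Real.log Q) * (10 ^ 466 * Q ^ 170) ^ (1 - σ) := by
  obtain ⟨D₀, H⟩ := exceptionalZero_of_assumptionA'
  refine ⟨max D₀ 3, fun D _ hD χ hχ hprim hA Q hQ σ hσ => ?_⟩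
  have hD₀ : D₀ ≤ D := le_trans (le_max_left _ _) hD
  have hD3 : 3 ≤ D := le_trans (le_max_right _ _) hD
  have hD3r : (3 : ℝ) ≤ D := by exact_mod_cast hD3
  have hQ3 : 3 ≤ Q := le_trans hD3r hQ
  obtain ⟨β₁, -, hβ1, hz, -, -, -, -, hgap⟩ := H D hD₀ χ hχ hA
  -- `β₁ ∈ realZeroSet Q`: write the modulus as `i + 1`
  obtain ⟨i, hi⟩ := Nat.exists_eq_succ_of_ne_zero (NeZero.ne D)
  subst hi
  have hmem : β₁ ∈ ThornerZaman2024.realZeroSet Q := by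
    refine ⟨i, ?_, χ, hprim, hz⟩
    have : i + 1 ≤ ⌊Q⌋₊ := Nat.le_floor hQ
    omega
  have hβQ : β₁ ≤ ThornerZaman2024.betaOne Q := le_csSup (realZeroSet_bddAbove Q) hmem
  -- Theorem 1.2, second conjunct
  obtain ⟨-, hN⟩ := h12 Q hQ3 σ hσ
  have hlogQ : 0 ≤ Real.log Q := Real.log_nonneg (by linarith)
  have hP : 0 ≤ ((10 : ℝ) ^ 466 * Q ^ 170) ^ (1 - σ) :=
    Real.rpow_nonneg (by positivity) _
  have hmin : min 1 ((1 - ThornerZaman2024.betaOne Q) * Real.log Q) ≤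
      25 / 18 / Real.log ((i + 1 : ℕ) : ℝ) ^ 2022 * Real.log Q := by
    refine (min_le_right _ _).trans ?_
    have h1 : (1 - ThornerZaman2024.betaOne Q) * Real.log Q ≤ (1 - β₁) * Real.log Q :=
      mul_le_mul_of_nonneg_right (by linarith) hlogQ
    have h2 : (1 - β₁) * Real.log Q ≤ 25 / 18 / Real.log ((i + 1 : ℕ) : ℝ) ^ 2022 * Real.log Q :=
      mul_le_mul_of_nonneg_right hgap.le hlogQ
    exact h1.trans h2
  refine hN.trans ?_
  have h10 : (0 : ℝ) ≤ 10 ^ 93 := by positivity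
  exact mul_le_mul_of_nonneg_right (mul_le_mul_of_nonneg_left hmin h10) hP

end Zhang2022.DH

end Literature.NumberTheory.LFunctions

end
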